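import Summits.QuantumFields.YangMills.Theses.TransportPerturbation
import HarnessLib

/-!
# Route `TransportPerturbation`, LINE 10 «harris_hybrid»: the glue item `LyapunovContractionOfHarrisHybrid`
# (stmt-QuantumFields-27875) — PROVED

Seat `ym-line-csu-p1` (g4), landing the planner's kernel-checked composition (ym-idea-5 g8, skeleton
`Cruxes/LyapunovContraction/Lines/harris_hybrid.lean` v3, `LyapunovContraction_of`; refuter joint-sufficiency check
13:08Z): the five gen-1 children `WeakHarrisOneStep → MultiscaleDrift → ClosePairContraction → RegularPairOverlap →
WindowSemigroup` imply the crux `LyapunovContraction` BY NAME.  Assembly (Hairer–Mattingly–Scheutzow hybrid):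
`γ₁ = min` of the three thresholds; `(a, τ, b)` from the multiscale drift; `(δ, α)` from the close-pair contraction at
`τ`; `η` from the regular-pair overlap at `(a, τ, 4b, δ)`; `(β, κ)` from the one-step weak Harris theorem; `n = m + 1`
windows with `κ^m < √δ/2`, contraction constant `κ' = 2κ^n/√δ < 1`, window `nτ`, weight `Λ_K = β N_K`, `D = 3βb`;
class transfer `√(wd·w) ≤ 2√(d_δ·w)` in and `√(d_δ·w) ≤ √(wd·w)/√δ` out (`d_δ = 1 ∧ wd/δ`); the `K1` window operator
is `Q_{nτ} = Q_τ^n` by `WindowSemigroup`.  The local abbreviations of the skeleton (`badCount`, `wdisc`, `dTr`) are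
replaced by `set`-bound names, so this file declares no definition.  No sorry; standard axioms.  Nothing here bears
on the mass gap, which is NOT proved; the five children remain OPEN except `WindowSemigroup` (closed in this tree).
-/

set_option autoImplicit false

noncomputable section

namespace Summit.QuantumFields.YangMills.Theorems.TransportPerturbation

open scoped BigOperators Topology MeasureTheory ProbabilityTheory NNReal ENNReal
open Filter Set Function MeasureTheory
open Literature.MathematicalPhysics.QuantumFieldTheory
open Literature.MathematicalPhysics.QuantumFieldTheory.Balaban1983to89
open Literature.MathematicalPhysics.QuantumLattice

/-- Class transfer in: `√(wd·w) ≤ 2·√((1 ∧ wd/δ)·w)` for `0 ≤ w`, `0 < δ ≤ 4`, `0 ≤ wd ≤ 4`. [folklore] -/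
theorem sqrt_wd_le (wd δ w : ℝ) (hδ : 0 < δ) (hδ4 : δ ≤ 4) (hwd0 : 0 ≤ wd) (hwd4 : wd ≤ 4) (hw : 0 ≤ w) :
    Real.sqrt (wd * w) ≤ 2 * Real.sqrt (min 1 (wd / δ) * w) := by
  have hle : wd ≤ 4 * min 1 (wd / δ) := by
    rcases le_total 1 (wd / δ) with h | h
    · rw [min_eq_left h]; linarith
    · rw [min_eq_right h]
      have : wd = δ * (wd / δ) := by field_simp
      nlinarith [div_nonneg hwd0 hδ.le]
  calc Real.sqrt (wd * w) ≤ Real.sqrt (4 * (min 1 (wd / δ) * w)) := by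
        apply Real.sqrt_le_sqrt
        nlinarith [mul_le_mul_of_nonneg_right hle hw]
    _ = 2 * Real.sqrt (min 1 (wd / δ) * w) := by
        rw [Real.sqrt_mul (by norm_num : (0:ℝ) ≤ 4), show Real.sqrt 4 = 2 by
          rw [show (4:ℝ) = 2 ^ 2 by norm_num, Real.sqrt_sq (by norm_num : (0:ℝ) ≤ 2)]]

/-- Class transfer out: `√((1 ∧ wd/δ)·w) ≤ √(wd·w)/√δ` for `0 ≤ w`, `0 < δ`, `0 ≤ wd`. [folklore] -/
theorem sqrt_dTr_le (wd δ w : ℝ) (hδ : 0 < δ) (hwd0 : 0 ≤ wd) (hw : 0 ≤ w) :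
    Real.sqrt (min 1 (wd / δ) * w) ≤ Real.sqrt (wd * w) / Real.sqrt δ := by
  rw [le_div_iff₀ (Real.sqrt_pos.mpr hδ), ← Real.sqrt_mul (mul_nonneg (le_min zero_le_one (div_nonneg hwd0 hδ.le)) hw)]
  apply Real.sqrt_le_sqrt
  have h1 : min 1 (wd / δ) ≤ wd / δ := min_le_right _ _
  have h2 : wd / δ * w * δ = wd * w := by field_simp
  nlinarith [mul_le_mul_of_nonneg_right (mul_le_mul_of_nonneg_right h1 hw) hδ.le]


/-- Iterates of a transition operator commute with scalar multiplication of the test function. [folklore] -/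
theorem iterate_markovTransition_smul {X Ω : Type} [MeasurableSpace X] [MeasurableSpace Ω]
    (U : X → ℝ≥0 → Ω → X) (P : Measure Ω) (t : ℝ≥0) (c : ℝ) (f : X → ℝ) (m : ℕ) :
    (markovTransition U P t)^[m] (fun x => c * f x) = fun x => c * ((markovTransition U P t)^[m] f) x := by
  induction m with
  | zero => rfl
  | succ n ih =>
    rw [Function.iterate_succ_apply', Function.iterate_succ_apply', ih]
    funext x
    simp only [markovTransition]
    exact integral_const_mul c _


/-- **`LyapunovContractionOfHarrisHybrid` (item stmt-QuantumFields-27875) holds**: the five gen-1 children of LINE 10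
imply the crux `LyapunovContraction` by name (HMS hybrid assembly, constants as in the module docstring).
[cite: HairerMattinglyScheutzow2011, Theorem 4.8 and its proof] -/
theorem lyapunovContractionOfHarrisHybrid_proof :
    Summit.QuantumFields.YangMills.Theses.TransportPerturbation.LyapunovContractionOfHarrisHybrid := by
  unfold Summit.QuantumFields.YangMills.Theses.TransportPerturbation.LyapunovContractionOfHarrisHybrid
  intro h1 h2 h3 h4 h5
  obtain ⟨γa, hγa, hA⟩ := h2
  obtain ⟨γc, hγc, hC⟩ := h3
  obtain ⟨γo, hγo, hO⟩ := h4
  refine ⟨min γa (min γc γo), lt_min hγa (lt_min hγc hγo), fun F γ hγ hγle => ?_⟩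
  have hγa' : γ ≤ γa := hγle.trans (min_le_left _ _)
  have hγc' : γ ≤ γc := hγle.trans ((min_le_right _ _).trans (min_le_left _ _))
  have hγo' : γ ≤ γo := hγle.trans ((min_le_right _ _).trans (min_le_right _ _))
  obtain ⟨a, τ, b, Ka, ha, hτ, hb, hKa⟩ := hA F γ hγ hγa'
  obtain ⟨δ, α, Kc, hδ, hδ4, hα0, hα1, hKc⟩ := hC F γ hγ hγc' τ hτ
  obtain ⟨η, Ko, hη, hKo⟩ := hO F γ hγ hγo' a τ (4 * b) δ ha hτ hδ
  obtain ⟨β, κ, hβ, hκ0, hκ1, hH⟩ := h1 α η b hα0 hα1 hη hb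
  -- number of windows: `κ^(m+1) · 2/√δ < 1`
  have hsδ : 0 < Real.sqrt δ := Real.sqrt_pos.mpr hδ
  obtain ⟨m, hm⟩ := exists_pow_lt_of_lt_one (div_pos hsδ two_pos) hκ1
  set n : ℕ := m + 1 with hn
  have hκn : κ ^ n ≤ κ ^ m := pow_le_pow_of_le_one hκ0 hκ1.le (Nat.le_succ m)
  have hκn0 : 0 ≤ κ ^ n := pow_nonneg hκ0 n
  set κ' : ℝ := κ ^ n * 2 / Real.sqrt δ with hκ'
  have hκ'0 : 0 ≤ κ' := div_nonneg (mul_nonneg hκn0 zero_le_two) hsδ.le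
  have hκ'1 : κ' < 1 := by
    rw [hκ', div_lt_one hsδ]
    have := mul_lt_mul_of_pos_right (lt_of_le_of_lt hκn hm) two_pos
    rw [div_mul_cancel₀ _ (two_ne_zero)] at this
    linarith
  have hnτ : 0 < (n : ℝ) * τ := mul_pos (by positivity) hτ
  refine ⟨κ', (n : ℝ) * τ, β * (3 * b), max Ka (max Kc Ko), hκ'0, hκ'1, hnτ, by positivity, fun K hK => ?_⟩
  have hKa' : Ka ≤ K := (le_max_left _ _).trans hK
  have hKc' : Kc ≤ K := ((le_max_left _ _).trans (le_max_right _ _)).trans hK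
  have hKo' : Ko ≤ K := ((le_max_right _ _).trans (le_max_right _ _)).trans hK
  -- the bad-block count `N_K` and the transport currency `wd_K`, named once
  set Vf : GaugeConfig 3 ((F.P K).sitesPerDir 0) (Matrix.specialUnitaryGroup (Fin 2) ℂ) → ℝ :=
    (fun u => (∑ j ∈ Finset.range (K + 1), ∑ p : Plaq (F.P K) j, if (γ * (F.P K).eps * (F.L : ℝ) ^ j) ^ a ≤ dist1 (GaugeField.plaqHol (Averaging.iter (fun i => BlockAveraging.blockAvg (P := F.P K) (j := i) ExpMeanLog.expMeanLogSU) j (fun b : PBond (F.P K) 0 => u (b.src, b.dir))) p) then (1 : ℝ) else 0)) with hVf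
  set wd : GaugeConfig 3 ((F.P K).sitesPerDir 0) (Matrix.specialUnitaryGroup (Fin 2) ℂ) → GaugeConfig 3 ((F.P K).sitesPerDir 0) (Matrix.specialUnitaryGroup (Fin 2) ℂ) → ℝ :=
    (fun u v => (∑ j ∈ Finset.range (K + 1), ((F.L : ℝ)⁻¹) ^ (K - j) * ⨅ h : GaugeTransf (F.P K) j (Matrix.specialUnitaryGroup (Fin 2) ℂ), ⨆ p : PBond (F.P K) j × Fin 2 × Fin 2, ‖(((Averaging.iter (fun i => BlockAveraging.blockAvg (P := F.P K) (j := i) ExpMeanLog.expMeanLogSU) j (fun b : PBond (F.P K) 0 => u (b.src, b.dir))) p.1 : Matrix.specialUnitaryGroup (Fin 2) ℂ) : Matrix (Fin 2) (Fin 2) ℂ) p.2.1 p.2.2 - ((GaugeField.gaugeAct h (Averaging.iter (fun i => BlockAveraging.blockAvg (P := F.P K) (j := i) ExpMeanLog.expMeanLogSU) j (fun b : PBond (F.P K) 0 => v (b.src, b.dir))) p.1 : Matrix.specialUnitaryGroup (Fin 2) ℂ) : Matrix (Fin 2) (Fin 2) ℂ) p.2.1 p.2.2‖)) with hwd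
  obtain ⟨hVm, hV0, ⟨M, hVM⟩, hμ, hν, hdrift⟩ := hKa K hKa' Vf hVf
  obtain ⟨hwdm, hwd0, hwd4, hcouple⟩ := hKc K hKc' wd hwd
  have hover := hKo K hKo' Vf wd hVf hwd
  -- the weight `Λ_K = β · N_K`
  refine ⟨fun u => β * Vf u, hVm.const_mul β, fun u => mul_nonneg hβ.le (hV0 u), ⟨β * M, fun u =>
    mul_le_mul_of_nonneg_left (hVM u) hβ.le⟩, ?_, ?_, fun Ω mΩ P hP W hW Vs hVs => ?_⟩
  · -- Gibbs_K moment
    have : (∫ U, β * Vf (fun e => U ⟨e.1, e.2⟩) ∂(T4GenFunBounds.gibbsMeasure (F.P K) ((F.scheme (ExpMeanLog.expMeanLogSU : LoopAverage (Matrix.specialUnitaryGroup (Fin 2) ℂ)) γ).β K))) ≤ β * (3 * b) := by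
      rw [integral_const_mul]
      exact mul_le_mul_of_nonneg_left (hμ.trans (by linarith)) hβ.le
    exact this
  · -- descended Gibbs_{K+1} moment
    have : (∫ U, β * Vf (fun e => T3NestedUnitLaws.descend F (ExpMeanLog.expMeanLogSU : LoopAverage (Matrix.specialUnitaryGroup (Fin 2) ℂ)) K U ⟨e.1, e.2⟩)
        ∂(T4GenFunBounds.gibbsMeasure (F.P (K + 1)) ((F.scheme (ExpMeanLog.expMeanLogSU : LoopAverage (Matrix.specialUnitaryGroup (Fin 2) ℂ)) γ).β (K + 1)))) ≤ β * (3 * b) := by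
      rw [integral_const_mul]
      exact mul_le_mul_of_nonneg_left (hν.trans (by linarith)) hβ.le
    exact this
  -- a solution family `Vs` on `(Ω, P)`; window operator `Q = Q_τ`, K1's operator `Q_{nτ} = Q^n`
  haveI : IsProbabilityMeasure P := hP
  set t : ℝ≥0 := (τ / (F.P K).eps).toNNReal with ht
  obtain ⟨Ω₁, mΩ₁, P₁, T₁, T₂, hcpl₁, hcontr⟩ := hcouple Ω mΩ P hP W hW Vs hVs
  obtain ⟨Ω₂, mΩ₂, P₂, T₃, T₄, hcpl₂, hsmall⟩ := hover Ω mΩ P hP W hW Vs hVs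
  have hdriftV := hdrift Ω mΩ P hP W hW Vs hVs
  -- the truncated currency
  set d : GaugeConfig 3 ((F.P K).sitesPerDir 0) (Matrix.specialUnitaryGroup (Fin 2) ℂ) → GaugeConfig 3 ((F.P K).sitesPerDir 0) (Matrix.specialUnitaryGroup (Fin 2) ℂ) → ℝ := fun u v => min 1 (wd u v / δ) with hd
  have hdxy : ∀ x y, d x y = min 1 (wd x y / δ) := fun x y => rfl
  have hdm : Measurable (fun p : GaugeConfig 3 ((F.P K).sitesPerDir 0) (Matrix.specialUnitaryGroup (Fin 2) ℂ) × GaugeConfig 3 ((F.P K).sitesPerDir 0) (Matrix.specialUnitaryGroup (Fin 2) ℂ) => d p.1 p.2) := by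
    simpa [hd] using (measurable_const.min (hwdm.div_const δ))
  have hd0 : ∀ x y, 0 ≤ d x y := fun x y => le_min zero_le_one (div_nonneg (hwd0 x y) hδ.le)
  have hd1 : ∀ x y, d x y ≤ 1 := fun x y => min_le_left _ _
  obtain ⟨hiter, hcls⟩ := hH (GaugeConfig 3 ((F.P K).sitesPerDir 0) (Matrix.specialUnitaryGroup (Fin 2) ℂ)) Ω Ω₁ Ω₂ P Vs t (hVs.2 t) P₁ T₁ T₂ P₂ T₃ T₄ hcpl₁ hcpl₂ Vf d hVm hV0 ⟨M, hVM⟩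
    hdm hd0 hd1 hdriftV hcontr hsmall
  have hCK := h5 F γ hγ K Ω mΩ P hP W hW Vs hVs τ hτ n
  constructor
  · -- moment of `Q_{nτ} Λ` under the descended Gibbs law
    have hΛb : ∃ M' : ℝ, ∀ u, |β * Vf u| ≤ M' :=
      ⟨β * M, fun u => by rw [abs_of_nonneg (mul_nonneg hβ.le (hV0 u))]; exact mul_le_mul_of_nonneg_left (hVM u) hβ.le⟩
    rw [hCK (fun u => β * Vf u) (hVm.const_mul β) hΛb, iterate_markovTransition_smul]
    rw [integral_const_mul]
    refine mul_le_mul_of_nonneg_left ?_ hβ.le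
    -- `∫ (Q^n N)∘desc ≤ ∫ (N∘desc + 2b) ≤ 3b`
    have hmeasD : Measurable (fun U : GaugeField (F.P (K + 1)) 0 (Matrix.specialUnitaryGroup (Fin 2) ℂ) =>
        (fun e : Edge 3 ((F.P K).sitesPerDir 0) => T3NestedUnitLaws.descend F (ExpMeanLog.expMeanLogSU : LoopAverage (Matrix.specialUnitaryGroup (Fin 2) ℂ)) K U ⟨e.1, e.2⟩)) := by
      refine measurable_pi_lambda _ fun e => ?_
      exact (measurable_pi_apply _).comp (T3NestedUnitLaws.measurable_descend F (ExpMeanLog.expMeanLogSU : LoopAverage (Matrix.specialUnitaryGroup (Fin 2) ℂ)) T4ApexTwoLevel.measurableE_expMeanLogSU K)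
    haveI : IsProbabilityMeasure (T4GenFunBounds.gibbsMeasure (F.P (K + 1)) ((F.scheme (ExpMeanLog.expMeanLogSU : LoopAverage (Matrix.specialUnitaryGroup (Fin 2) ℂ)) γ).β (K + 1))) :=
      T4GenFunBounds.isProbabilityMeasure_gibbsMeasure (G := (Matrix.specialUnitaryGroup (Fin 2) ℂ)) (F.P (K + 1)) (F.scheme_β_nonneg (ExpMeanLog.expMeanLogSU : LoopAverage (Matrix.specialUnitaryGroup (Fin 2) ℂ)) hγ.le (K + 1))
    have hQn := fun x => hiter n x
    obtain ⟨u₀⟩ : Nonempty (GaugeConfig 3 ((F.P K).sitesPerDir 0) (Matrix.specialUnitaryGroup (Fin 2) ℂ)) := ⟨fun _ => 1⟩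
    have hQnm : Measurable ((markovTransition Vs P t)^[n] Vf) := (hQn u₀).1
    have hint1 : Integrable (fun U : GaugeField (F.P (K + 1)) 0 (Matrix.specialUnitaryGroup (Fin 2) ℂ) =>
        ((markovTransition Vs P t)^[n] Vf) (fun e => T3NestedUnitLaws.descend F (ExpMeanLog.expMeanLogSU : LoopAverage (Matrix.specialUnitaryGroup (Fin 2) ℂ)) K U ⟨e.1, e.2⟩))
        (T4GenFunBounds.gibbsMeasure (F.P (K + 1)) ((F.scheme (ExpMeanLog.expMeanLogSU : LoopAverage (Matrix.specialUnitaryGroup (Fin 2) ℂ)) γ).β (K + 1))) := by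
      refine Integrable.mono' (integrable_const (M + 2 * b)) (hQnm.comp hmeasD |>.aestronglyMeasurable)
        (ae_of_all _ fun U => ?_)
      rw [Real.norm_eq_abs, abs_of_nonneg (hQn _).2.1]
      exact (hQn _).2.2.trans (by linarith [hVM (fun e => T3NestedUnitLaws.descend F (ExpMeanLog.expMeanLogSU : LoopAverage (Matrix.specialUnitaryGroup (Fin 2) ℂ)) K U ⟨e.1, e.2⟩)])
    have hint2 : Integrable (fun U : GaugeField (F.P (K + 1)) 0 (Matrix.specialUnitaryGroup (Fin 2) ℂ) =>
        Vf (fun e => T3NestedUnitLaws.descend F (ExpMeanLog.expMeanLogSU : LoopAverage (Matrix.specialUnitaryGroup (Fin 2) ℂ)) K U ⟨e.1, e.2⟩) + 2 * b)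
        (T4GenFunBounds.gibbsMeasure (F.P (K + 1)) ((F.scheme (ExpMeanLog.expMeanLogSU : LoopAverage (Matrix.specialUnitaryGroup (Fin 2) ℂ)) γ).β (K + 1))) := by
      refine Integrable.add ?_ (integrable_const _)
      refine Integrable.mono' (integrable_const M) (hVm.comp hmeasD |>.aestronglyMeasurable) (ae_of_all _ fun U => ?_)
      have hVU := hVM (fun e => T3NestedUnitLaws.descend F (ExpMeanLog.expMeanLogSU : LoopAverage (Matrix.specialUnitaryGroup (Fin 2) ℂ)) K U ⟨e.1, e.2⟩)
      have h0U := hV0 (fun e => T3NestedUnitLaws.descend F (ExpMeanLog.expMeanLogSU : LoopAverage (Matrix.specialUnitaryGroup (Fin 2) ℂ)) K U ⟨e.1, e.2⟩)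
      rw [Real.norm_eq_abs, abs_le]
      exact ⟨by linarith, hVU⟩
    calc (∫ U, ((markovTransition Vs P t)^[n] Vf) (fun e => T3NestedUnitLaws.descend F (ExpMeanLog.expMeanLogSU : LoopAverage (Matrix.specialUnitaryGroup (Fin 2) ℂ)) K U ⟨e.1, e.2⟩)
            ∂(T4GenFunBounds.gibbsMeasure (F.P (K + 1)) ((F.scheme (ExpMeanLog.expMeanLogSU : LoopAverage (Matrix.specialUnitaryGroup (Fin 2) ℂ)) γ).β (K + 1))))
        ≤ ∫ U, (Vf (fun e => T3NestedUnitLaws.descend F (ExpMeanLog.expMeanLogSU : LoopAverage (Matrix.specialUnitaryGroup (Fin 2) ℂ)) K U ⟨e.1, e.2⟩) + 2 * b)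
            ∂(T4GenFunBounds.gibbsMeasure (F.P (K + 1)) ((F.scheme (ExpMeanLog.expMeanLogSU : LoopAverage (Matrix.specialUnitaryGroup (Fin 2) ℂ)) γ).β (K + 1))) :=
          integral_mono hint1 hint2 fun U => (hQn _).2.2
      _ = (∫ U, Vf (fun e => T3NestedUnitLaws.descend F (ExpMeanLog.expMeanLogSU : LoopAverage (Matrix.specialUnitaryGroup (Fin 2) ℂ)) K U ⟨e.1, e.2⟩)
            ∂(T4GenFunBounds.gibbsMeasure (F.P (K + 1)) ((F.scheme (ExpMeanLog.expMeanLogSU : LoopAverage (Matrix.specialUnitaryGroup (Fin 2) ℂ)) γ).β (K + 1)))) + 2 * b := by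
          rw [integral_add (hint2.sub (integrable_const (2 * b)) |>.congr ?_) (integrable_const _)]
          · simp
          · exact ae_of_all _ fun U => by simp
      _ ≤ 3 * b := by linarith
  · intro T hT A g hg
    have hT' : ∀ u v, T u v = Real.sqrt (wd u v * (1 + β * Vf u + β * Vf v)) := hT
    have hw0 : ∀ u v, 0 ≤ 1 + β * Vf u + β * Vf v := fun u v =>
      add_nonneg (add_nonneg zero_le_one (mul_nonneg hβ.le (hV0 u))) (mul_nonneg hβ.le (hV0 v))
    have hgb : ∃ M' : ℝ, ∀ u, |g u| ≤ M' := ⟨1, hg.2.1⟩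
    rw [hCK g hg.1 hgb]
    by_cases hA : 0 ≤ A
    · -- transfer into the `d`-class with constant `2A`, contract `n` times, transfer back with `1/√δ`
      have hg' : Measurable g ∧ (∀ x, |g x| ≤ 1) ∧
          ∀ x y, |g x - g y| ≤ (2 * A) * Real.sqrt (d x y * (1 + β * Vf x + β * Vf y)) := by
        refine ⟨hg.1, hg.2.1, fun x y => (hg.2.2 x y).trans ?_⟩
        rw [hT' x y, hdxy x y]
        have := mul_le_mul_of_nonneg_left (sqrt_wd_le _ _ _ hδ hδ4 (hwd0 x y) (hwd4 x y) (hw0 x y)) hA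
        linarith [this]
      obtain ⟨hm1, hm2, hm3⟩ := hcls n (2 * A) g (by positivity) hg'
      refine ⟨hm1, hm2, fun u v => (hm3 u v).trans ?_⟩
      rw [hT' u v]
      have hstep := sqrt_dTr_le (wd u v) δ _ hδ (hwd0 u v) (hw0 u v)
      have hcoef : 0 ≤ κ ^ n * (2 * A) := mul_nonneg hκn0 (by positivity)
      calc κ ^ n * (2 * A) * Real.sqrt (d u v * (1 + β * Vf u + β * Vf v))
          ≤ κ ^ n * (2 * A) * (Real.sqrt (wd u v * (1 + β * Vf u + β * Vf v)) / Real.sqrt δ) :=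
            mul_le_mul_of_nonneg_left hstep hcoef
        _ = κ' * A * Real.sqrt (wd u v * (1 + β * Vf u + β * Vf v)) := by
            rw [hκ']; field_simp
    · -- `A < 0`: the class forces `T ≡ 0`, and the `A = 0` instance of the main step does the rest
      push Not at hA
      have hT0 : ∀ u v, T u v = 0 := fun u v => by
        have h1 : 0 ≤ A * T u v := (abs_nonneg _).trans (hg.2.2 u v)
        have h2 : 0 ≤ T u v := by rw [hT' u v]; exact Real.sqrt_nonneg _
        nlinarith
      have hg' : Measurable g ∧ (∀ x, |g x| ≤ 1) ∧
          ∀ x y, |g x - g y| ≤ (0 : ℝ) * Real.sqrt (d x y * (1 + β * Vf x + β * Vf y)) := by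
        refine ⟨hg.1, hg.2.1, fun x y => ?_⟩
        have := hg.2.2 x y
        rw [hT0 x y, mul_zero] at this
        simpa using this
      obtain ⟨hm1, hm2, hm3⟩ := hcls n 0 g le_rfl hg'
      refine ⟨hm1, hm2, fun u v => (hm3 u v).trans ?_⟩
      rw [hT0 u v]; simp


end Summit.QuantumFields.YangMills.Theorems.TransportPerturbation

end
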